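import Summits.QuantumFields.YangMills.Theorems.BalabanUVNodesN20KeyedRelWeightUnionReading

/-!
# BalabanUVNodes ∕ N20 (NE7b) — VALUE-PREDICATE BAD READINGS (any decidable predicate on an ℕ-valued key statistic: thresholds, WINDOWS, finite unions of windows): exact value
# stratification, the per-value socket, and the SIZE-DEPENDENT over-age booking (per-level size WINDOWS below a budget inverse) as a union of window readings at the forgiving key

Cell `pub-ymgap` (HUMAN RULING D-0062 Track A; work-bound push D-0149, director-ym №197), width seat `pub-ymgap-dag-n20-w2` (gen 4) on node N20 = NE7b; CLAIM-4 of the re-seat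
(this lineage's SIZE socket p620106 `…ValueStrata` generalised from thresholds `n ≤ φ` to arbitrary value predicates `P (φ u)`, so that the trigger (t4) of the g4 HANDOFF — «a
size-DEPENDENT budget `bud(m)` makes the over-age piece per level a LOWER size window» — has its socket).  Filed `--kind proof --supports stmt-QuantumFields-20544 --as helper` (K3⁷
`SpineGivenEndpointR13SepCoPH`; skeleton v5 941dddb108cbaacf STANDS); COUNT-NEUTRAL; LOCATED.  [LF-I] = [Balaban1989LargeFieldI], [LF-II] = [Balaban1989LargeFieldII].

WHY.  p620106 prices THRESHOLD readings `n K ≤ φ K u` (upper value tails) and p622010 unions of readings; p623956 reads the crux cards' over-age booking with a UNIFORM budget `bud` as a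
level cut.  With (1.80)'s size-dependent budget `K(Z)` («the number K is the smallest positive integer having the property that S^K(Z) satisfies (i), (ii)», [LF-II] p.384 — growing with
the region), «over-aged at level `j+1`» reads «size `m` with `bud(m) + margin ≤ age_j`», i.e. a LOWER size WINDOW `1 ≤ φ j K u < N j K` per level (`N j K` = the budget's inverse at the
level's age): neither a threshold nor a level cut.  The bookkeeping is the same for EVERY value predicate: the coarse bad class of `bd K u ⟺ P K (φ K u)` is the disjoint union of the value
fibres `{φ K · = m}` over the attained values with `P K m` (§1–§2, exact), so `W K ≤ Σ_{m ∈ values, P K m}` per-value fractions and the face follows from per-value budgets (§3); windows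
are the instance `P K m := lo K ≤ m ∧ m < hi K` (§3, with «a window costs at most its lower threshold» by p622010's monotonicity), and the size-dependent over-age booking at the forgiving
key is the union over the window's levels of such windows, priced by p622010 §2 + §3 per level (§4).  Which per-(level, size) letter prices an over-aged region of size `m` (activity per
step `∝ |Z|`, [LF-II] p.380) is NOT decided here — the socket takes arbitrary per-value fractions.
CONTENTS (theorems only; 0 `def`):
* §1 (folklore) `sum_filter_valuePred_eq_sum_fibers` · `sum_filter_valuePred_le_of_valueFractions`;
* §2 (coarse carriers, any dial) `mem_badClassK₁₃_valuePred_iff` · `badClassK₁₃_valuePred_eq_filter` · `badClassK₁₃_valuePred_mono_at` · ★★ `sum_badClassK₁₃_valuePred_eq_sum_values` ·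
  `badClassK₁₃_window_subset_thr` (a window lies inside its lower threshold class);
* §3 (at the reading whose `bd` reads as `P K (φ K ·)` on the class set) ★★ `W_crOfRecord₁₃KAt_valuePred_le_sum_values` · ★★ `relWeightBound_crOfRecord₁₃KAt_valuePred_of_valueFractions` ·
  ★ `W_crOfRecord₁₃KAt_window_le_thr` (a window reading costs at most its lower threshold reading — so every p620106 ∕ p623956 rule prices windows from above);
* §4 (the SIZE-DEPENDENT over-age booking at the NAMED forgiving key: `∃ j < jcut K, loR j K ≤ vol_{j+1} < hiR j K`) ★★ `W_forgiveCompReading₁₃_overAgeWindows_le_sum` (≤ the sum over the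
  window's levels of the per-level window readings' canonical weights) · ★★ `relWeightBound_forgiveCompReading₁₃_overAgeWindows_of_budgets` (per-(level) budgets `w j K`, `Σ_{j<jcut K} w j K < 1`
  summable ⇒ the face).
Cited BY NAME: dag-n20-d `…CoPHK ∕ …CoPHKForgive` (`crOfRecord₁₃KAt`, `classSetK₁₃`, `badClassK₁₃`, `mem_badClassK₁₃_iff`, `forgiveCompReading₁₃`), `Node00.largeFieldVolume`; this seat's
p610465 §1, p620106 §1–§3 (`badClassK₁₃_congr_on`), p622010 §2 (`W_crOfRecord₁₃KAt_mono_bad`, `W_crOfRecord₁₃KAt_le_sum_of_subset_biUnion`, `relWeightBound_crOfRecord₁₃KAt_of_pieceBudgets`),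
p617084 (`forgiveKeyCompSigma_fst_eq`).

HONEST FRAMING.  [folklore] finite-sum bookkeeping BY NAME; every per-value fraction ∕ budget is a HYPOTHESIS (NE7b's body at the coarse key, NAMED OPEN, NOT PRINTED for `d = 4`, NOT
proved, inhabited for no Bałaban family); NO weight bounded, NO estimate proved; the window shape is ONE key-language reading of (1.80)'s size-dependent budget, NOT Bałaban's `K(Z)` with
its conditions (i), (ii) of [LF-I] p.177; nothing of Bałaban's asserted; (α)-instance 0∕1; K0⁷ open; N19 ∕ N20 ∕ N21 ∕ N27 NOT discharged; K3⁷ NOT closed (v5 stands; no dial ∕ bad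
reading is pinned by any registered text); counts unmoved (typed 28∕28 · discharged 5∕27); no count claim (the chair's single count line is the only count).  One finite `𝕋⁴_{L^K}`
programme at fixed `ε = L^{−K}`, Bałaban AS PRINTED; the YM mass gap (Clay) is NOT proved by any of this — R4 closes the conditional finite-𝕋⁴ rung `BalabanLadder.UV` only; NOT ℝ⁴ ∕
infinite volume ∕ OS.  No `def` ∕ `instance` ∕ `notation` ∕ `sorry`.  Sources (locators only): [LF-II] Thm 1 + (0.1) pp.355–356, (1.79)–(1.80) pp.383–384, p.380, (1.89) p.387;
[LF-I] p.177; [King1986] (3.10)–(3.11) p.656.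
-/

noncomputable section

open scoped BigOperators

namespace Summit.QuantumFields.YangMills.BalabanUVNodes.N20KeyedRelWeightValuePredicate

open Literature.MathematicalPhysics.QuantumFieldTheory.Balaban1983to89 Literature.MathematicalPhysics.QuantumFieldTheory.Balaban1983to89.Node00
open T4Continuum
open T4WeightBudget (RelWeightBound)
open YMDAG.UVSplit hiding SU
open Summit.QuantumFields.YangMills.BalabanUVNodes.SpineCanonicalWeights
open Summit.QuantumFields.YangMills.BalabanUVNodes.N20KeyedRelWeightAtKeyReading
open Summit.QuantumFields.YangMills.BalabanUVNodes.N20KeyedRelWeightAtForgivingKey (forgiveKeyCompSigma_fst_eq)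
open Summit.QuantumFields.YangMills.BalabanUVNodes.N20KeyedRelWeightValueStrata (badClassK₁₃_congr_on)
open Summit.QuantumFields.YangMills.BalabanUVNodes.N20KeyedRelWeightUnionReading

variable {F : T4Family} {N : ℕ} [NeZero N]

/-! ## §1  Folklore: a value-predicate class is the disjoint union of its value fibres -/
section Fibers
variable {ι : Type*} (S : Finset ι) (φ : ι → ℕ) (P : ℕ → Prop) [DecidablePred P]

/-- **★ THE VALUE STRATIFICATION OF A VALUE-PREDICATE CLASS** (exact): `Σ_{u ∈ S, P (φ u)} f u = Σ_{m ∈ φ(S), P m} Σ_{u ∈ S, φ u = m} f u`.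
[cite: Balaban1989LargeFieldII, (1.79)–(1.80) pp.383–384 (bookkeeping)] -/
theorem sum_filter_valuePred_eq_sum_fibers (f : ι → ℝ) :
    ∑ u ∈ S.filter (fun u => P (φ u)), f u = ∑ m ∈ (S.image φ).filter P, ∑ u ∈ S.filter (fun u => φ u = m), f u := by
  rw [← Finset.sum_fiberwise_of_maps_to (s := S.filter (fun u => P (φ u))) (t := (S.image φ).filter P) (g := φ)
    (fun u hu => Finset.mem_filter.2 ⟨Finset.mem_image_of_mem φ (Finset.mem_filter.1 hu).1, (Finset.mem_filter.1 hu).2⟩)]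
  refine Finset.sum_congr rfl fun m hm => Finset.sum_congr ?_ fun _ _ => rfl
  ext u
  simp only [Finset.mem_filter]
  constructor
  · rintro ⟨⟨hu, -⟩, h⟩
    exact ⟨hu, h⟩
  · rintro ⟨hu, h⟩
    exact ⟨⟨hu, h ▸ (Finset.mem_filter.1 hm).2⟩, h⟩

/-- **PER-VALUE FRACTIONS SUM** over the values selected by the predicate. [cite: Balaban1989LargeFieldII, (1.80) p.384, (1.89) p.387 (bookkeeping)] -/
theorem sum_filter_valuePred_le_of_valueFractions (f : ι → ℝ) {a : ℕ → ℝ}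
    (hfrac : ∀ m, P m → ∑ u ∈ S.filter (fun u => φ u = m), f u ≤ a m * ∑ u ∈ S, f u) :
    ∑ u ∈ S.filter (fun u => P (φ u)), f u ≤ (∑ m ∈ (S.image φ).filter P, a m) * ∑ u ∈ S, f u := by
  rw [sum_filter_valuePred_eq_sum_fibers S φ P f, Finset.sum_mul]
  exact Finset.sum_le_sum fun m hm => hfrac m (Finset.mem_filter.1 hm).2

end Fibers

/-! ## §2  At dag-n20-d's coarse carriers, ANY dial: the coarse bad class of a VALUE-PREDICATE reading and its value strata; windows -/
section ValuePred
variable (θ : Stage13HParams F N) (K₀ : ℕ) (g₀ : ℕ → ℝ) (kr : ℕ → (Σ K, SiteSeqKey F (K₀ + K)) → (Σ K, SiteSeqKey F (K₀ + K)))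
  (φ : ℕ → (Σ K, SiteSeqKey F (K₀ + K)) → ℕ) (P : ℕ → ℕ → Prop)

/-- **MEMBERSHIP UNDER A VALUE-PREDICATE READING** `bd K u := P K (φ K u)`. [cite: Balaban1989LargeFieldII, (1.80) p.384 (bookkeeping)] -/
theorem mem_badClassK₁₃_valuePred_iff (K : ℕ) (t : ℝ) (u : Σ K, SiteSeqKey F (K₀ + K)) :
    u ∈ badClassK₁₃ θ K₀ g₀ kr (fun K u => P K (φ K u)) K t ↔ u ∈ classSetK₁₃ θ K₀ g₀ kr K ∧ P K (φ K u) :=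
  mem_badClassK₁₃_iff θ K₀ g₀ kr _ K t u

/-- **MONOTONE IN THE PREDICATE** (at one step): a stronger value predicate selects a sub-class. [cite: Balaban1989LargeFieldII, (1.80) p.384 (bookkeeping)] -/
theorem badClassK₁₃_valuePred_mono_at {P' : ℕ → ℕ → Prop} {K : ℕ} (h : ∀ m, P K m → P' K m) (t : ℝ) :
    badClassK₁₃ θ K₀ g₀ kr (fun K u => P K (φ K u)) K t ⊆ badClassK₁₃ θ K₀ g₀ kr (fun K u => P' K (φ K u)) K t := by
  intro u hu
  rw [mem_badClassK₁₃_iff] at hu ⊢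
  exact ⟨hu.1, h _ hu.2⟩

/-- **A WINDOW LIES INSIDE ITS LOWER THRESHOLD CLASS**: `lo K ≤ φ < hi K` ⇒ `lo K ≤ φ`. [cite: Balaban1989LargeFieldII, (1.80) p.384 (bookkeeping)] -/
theorem badClassK₁₃_window_subset_thr (lo hi : ℕ → ℕ) (K : ℕ) (t : ℝ) :
    badClassK₁₃ θ K₀ g₀ kr (fun K u => lo K ≤ φ K u ∧ φ K u < hi K) K t ⊆ badClassK₁₃ θ K₀ g₀ kr (fun K u => lo K ≤ φ K u) K t := by
  intro u hu
  rw [mem_badClassK₁₃_iff] at hu ⊢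
  exact ⟨hu.1, hu.2.1⟩

variable [∀ K, DecidablePred (P K)]

/-- The value-predicate class as a decidable filter of the coarse class set. [cite: Balaban1989LargeFieldII, (1.80) p.384 (bookkeeping)] -/
theorem badClassK₁₃_valuePred_eq_filter (K : ℕ) (t : ℝ) :
    badClassK₁₃ θ K₀ g₀ kr (fun K u => P K (φ K u)) K t = (classSetK₁₃ θ K₀ g₀ kr K).filter (fun u => P K (φ K u)) := by
  ext u
  rw [mem_badClassK₁₃_valuePred_iff, Finset.mem_filter]

/-- **★★ THE VALUE STRATIFICATION OF THE COARSE BAD CLASS OF A VALUE-PREDICATE READING** (any dial, any statistic, exact).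
[cite: Balaban1989LargeFieldII, (1.79)–(1.80) pp.383–384, (1.89) p.387 (bookkeeping)] -/
theorem sum_badClassK₁₃_valuePred_eq_sum_values (K : ℕ) (t : ℝ) (f : (Σ K, SiteSeqKey F (K₀ + K)) → ℝ) :
    ∑ u ∈ badClassK₁₃ θ K₀ g₀ kr (fun K u => P K (φ K u)) K t, f u =
      ∑ m ∈ ((classSetK₁₃ θ K₀ g₀ kr K).image (φ K)).filter (P K), ∑ u ∈ (classSetK₁₃ θ K₀ g₀ kr K).filter (fun u => φ K u = m), f u := by
  rw [badClassK₁₃_valuePred_eq_filter]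
  exact sum_filter_valuePred_eq_sum_fibers _ (φ K) (P K) f

end ValuePred

/-! ## §3  The sockets at the reading whose bad reading READS AS a value predicate on the coarse class set; windows cost at most thresholds -/
section Sockets
variable (θ : Stage13HParams F N) (hP : θ.Provisos₁₃CoPH F N) (K₀ : ℕ) (g₀ : ℕ → ℝ) (os : List (ULoop F)) (krR : KeyReading₁₃ N K₀) (bdR : BadKeyReading₁₃ N K₀)
  (sh : ShellSplit₁₃CoPH N K₀) (φ : ℕ → (Σ K, SiteSeqKey F (K₀ + K)) → ℕ) (P : ℕ → ℕ → Prop) [∀ K, DecidablePred (P K)]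
  (hbd : ∀ K, ∀ u ∈ classSetK₁₃ θ K₀ g₀ (krR F θ hP g₀ os) K, (bdR F θ hP g₀ os K u ↔ P K (φ K u)))
include hbd

/-- **★★ THE READING's FRACTION IS AT MOST THE SUM OF THE PER-VALUE FRACTIONS OVER THE SELECTED VALUES** (any dial; per-value relative bounds `a m K ≥ 0` ∕ `b m K` at the coarse carriers
for the attained values with `P K m`, `|t| ≤ 1`). [cite: Balaban1989LargeFieldII, (1.80) p.384, (1.89) p.387; King1986, (3.10)–(3.11) p.656 (bookkeeping)] -/
theorem W_crOfRecord₁₃KAt_valuePred_le_sum_values {a b : ℕ → ℕ → ℝ} (K : ℕ) (ha : ∀ m, P K m → 0 ≤ a m K)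
    (hA : ∀ t : ℝ, |t| ≤ 1 → ∀ m, P K m →
      ∑ u ∈ (classSetK₁₃ θ K₀ g₀ (krR F θ hP g₀ os) K).filter (fun u => φ K u = m), weightAK₁₃ θ hP K₀ g₀ os (krR F θ hP g₀ os) K t u ≤
        a m K * ∑ u ∈ classSetK₁₃ θ K₀ g₀ (krR F θ hP g₀ os) K, weightAK₁₃ θ hP K₀ g₀ os (krR F θ hP g₀ os) K t u)
    (hB : ∀ t : ℝ, |t| ≤ 1 → ∀ m, P K m →
      ∑ u ∈ (classSetK₁₃ θ K₀ g₀ (krR F θ hP g₀ os) K).filter (fun u => φ K u = m), weightBK₁₃ θ hP K₀ g₀ os (krR F θ hP g₀ os) K t u ≤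
        b m K * ∑ u ∈ classSetK₁₃ θ K₀ g₀ (krR F θ hP g₀ os) K, weightBK₁₃ θ hP K₀ g₀ os (krR F θ hP g₀ os) K t u) :
    (crOfRecord₁₃KAt K₀ krR bdR sh F θ hP g₀ os).W K ≤ ∑ m ∈ ((classSetK₁₃ θ K₀ g₀ (krR F θ hP g₀ os) K).image (φ K)).filter (P K), max (a m K) (b m K) := by
  have hcl : ∀ t : ℝ, badClassK₁₃ θ K₀ g₀ (krR F θ hP g₀ os) (bdR F θ hP g₀ os) K t = badClassK₁₃ θ K₀ g₀ (krR F θ hP g₀ os) (fun K u => P K (φ K u)) K t :=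
    fun t => badClassK₁₃_congr_on θ K₀ g₀ (krR F θ hP g₀ os) (hbd K) t
  refine wInf_le_of_mem ⟨Finset.sum_nonneg fun m hm => (ha m (Finset.mem_filter.1 hm).2).trans (le_max_left _ _), fun t ht => ⟨?_, ?_⟩⟩
  · show ∑ u ∈ badClassK₁₃ θ K₀ g₀ (krR F θ hP g₀ os) (bdR F θ hP g₀ os) K t, weightAK₁₃ θ hP K₀ g₀ os (krR F θ hP g₀ os) K t u ≤ _
    rw [hcl t, sum_badClassK₁₃_valuePred_eq_sum_values θ K₀ g₀ (krR F θ hP g₀ os) φ P K t, Finset.sum_mul]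
    exact Finset.sum_le_sum fun m hm => (hA t ht m (Finset.mem_filter.1 hm).2).trans
      (mul_le_mul_of_nonneg_right (le_max_left _ _) (Finset.sum_nonneg fun u _ => weightAK₁₃_nonneg_of_provisos θ hP K₀ g₀ os (krR F θ hP g₀ os) K t u))
  · show ∑ u ∈ badClassK₁₃ θ K₀ g₀ (krR F θ hP g₀ os) (bdR F θ hP g₀ os) K t, weightBK₁₃ θ hP K₀ g₀ os (krR F θ hP g₀ os) K t u ≤ _
    rw [hcl t, sum_badClassK₁₃_valuePred_eq_sum_values θ K₀ g₀ (krR F θ hP g₀ os) φ P K t, Finset.sum_mul]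
    exact Finset.sum_le_sum fun m hm => (hB t ht m (Finset.mem_filter.1 hm).2).trans
      (mul_le_mul_of_nonneg_right (le_max_right _ _) (Finset.sum_nonneg fun u _ => weightBK₁₃_nonneg_of_provisos θ hP K₀ g₀ os (krR F θ hP g₀ os) K t u))

/-- **★★ N20 AT THE READING FROM PER-VALUE BUDGETS OVER THE SELECTED VALUES**: value sums `< 1` at every step and summable ⇒ `RelWeightBound` AT `crOfRecord₁₃KAt K₀ kr bd sh F θ hP g₀ os`
with its canonical `W`.  The per-value bounds are NE7b's body at the coarse key — NAMED OPEN. [cite: Balaban1989LargeFieldII, Thm 1 + (0.1) pp.355–356, (1.80) p.384, (1.89) p.387; King1986, (3.10)–(3.11) p.656 (bookkeeping)] -/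
theorem relWeightBound_crOfRecord₁₃KAt_valuePred_of_valueFractions {a b : ℕ → ℕ → ℝ} (ha : ∀ K m, P K m → 0 ≤ a m K)
    (hA : ∀ (K : ℕ) (t : ℝ), |t| ≤ 1 → ∀ m, P K m →
      ∑ u ∈ (classSetK₁₃ θ K₀ g₀ (krR F θ hP g₀ os) K).filter (fun u => φ K u = m), weightAK₁₃ θ hP K₀ g₀ os (krR F θ hP g₀ os) K t u ≤
        a m K * ∑ u ∈ classSetK₁₃ θ K₀ g₀ (krR F θ hP g₀ os) K, weightAK₁₃ θ hP K₀ g₀ os (krR F θ hP g₀ os) K t u)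
    (hB : ∀ (K : ℕ) (t : ℝ), |t| ≤ 1 → ∀ m, P K m →
      ∑ u ∈ (classSetK₁₃ θ K₀ g₀ (krR F θ hP g₀ os) K).filter (fun u => φ K u = m), weightBK₁₃ θ hP K₀ g₀ os (krR F θ hP g₀ os) K t u ≤
        b m K * ∑ u ∈ classSetK₁₃ θ K₀ g₀ (krR F θ hP g₀ os) K, weightBK₁₃ θ hP K₀ g₀ os (krR F θ hP g₀ os) K t u)
    (hlt : ∀ K, ∑ m ∈ ((classSetK₁₃ θ K₀ g₀ (krR F θ hP g₀ os) K).image (φ K)).filter (P K), max (a m K) (b m K) < 1)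
    (hsum : Summable fun K => ∑ m ∈ ((classSetK₁₃ θ K₀ g₀ (krR F θ hP g₀ os) K).image (φ K)).filter (P K), max (a m K) (b m K)) :
    RelWeightBound (crOfRecord₁₃KAt K₀ krR bdR sh F θ hP g₀ os).l₀ (crOfRecord₁₃KAt K₀ krR bdR sh F θ hP g₀ os).T (crOfRecord₁₃KAt K₀ krR bdR sh F θ hP g₀ os).A
      (crOfRecord₁₃KAt K₀ krR bdR sh F θ hP g₀ os).B (crOfRecord₁₃KAt K₀ krR bdR sh F θ hP g₀ os).Bad (crOfRecord₁₃KAt K₀ krR bdR sh F θ hP g₀ os).W := by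
  have hle : ∀ K, (crOfRecord₁₃KAt K₀ krR bdR sh F θ hP g₀ os).W K ≤ ∑ m ∈ ((classSetK₁₃ θ K₀ g₀ (krR F θ hP g₀ os) K).image (φ K)).filter (P K), max (a m K) (b m K) :=
    fun K => W_crOfRecord₁₃KAt_valuePred_le_sum_values θ hP K₀ g₀ os krR bdR sh φ P hbd K (ha K) (hA K) (hB K)
  exact (relWeightBound_crOfRecord₁₃KAt_iff θ hP K₀ g₀ os krR bdR sh).2
    ⟨fun K => (hle K).trans_lt (hlt K), Summable.of_nonneg_of_le (fun K => wInf_nonneg K) hle hsum⟩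

end Sockets

section Window
variable (θ : Stage13HParams F N) (hP : θ.Provisos₁₃CoPH F N) (K₀ : ℕ) (g₀ : ℕ → ℝ) (os : List (ULoop F)) (krR : KeyReading₁₃ N K₀) (bdW bdT : BadKeyReading₁₃ N K₀)
  (sh : ShellSplit₁₃CoPH N K₀) (φ : ℕ → (Σ K, SiteSeqKey F (K₀ + K)) → ℕ) (lo hi : ℕ → ℕ)

/-- **★ A WINDOW READING COSTS AT MOST ITS LOWER THRESHOLD READING** (`bdW` reads as `lo K ≤ φ < hi K`, `bdT` as `lo K ≤ φ`, on the class set; p622010's monotonicity) — so every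
threshold rule of p620106 ∕ p623956 prices windows from above. [cite: Balaban1989LargeFieldII, (1.80) p.384; King1986, (3.10)–(3.11) p.656 (bookkeeping)] -/
theorem W_crOfRecord₁₃KAt_window_le_thr (K : ℕ)
    (hW : ∀ u ∈ classSetK₁₃ θ K₀ g₀ (krR F θ hP g₀ os) K, (bdW F θ hP g₀ os K u ↔ lo K ≤ φ K u ∧ φ K u < hi K))
    (hT : ∀ u ∈ classSetK₁₃ θ K₀ g₀ (krR F θ hP g₀ os) K, (bdT F θ hP g₀ os K u ↔ lo K ≤ φ K u)) :
    (crOfRecord₁₃KAt K₀ krR bdW sh F θ hP g₀ os).W K ≤ (crOfRecord₁₃KAt K₀ krR bdT sh F θ hP g₀ os).W K :=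
  W_crOfRecord₁₃KAt_mono_bad θ hP K₀ g₀ os krR sh bdW bdT K fun u hu hb => (hT u hu).2 ((hW u hu).1 hb).1

end Window

/-! ## §4  The SIZE-DEPENDENT over-age booking at the NAMED forgiving key: a union over the window's levels of per-level size WINDOWS -/
section OverAgeWindows
variable (θ : Stage13HParams F N) (hP : θ.Provisos₁₃CoPH F N) (K₀ : ℕ) (g₀ : ℕ → ℝ) (os : List (ULoop F)) (cR : FloorReading₁₃ N) (loR hiR : ℕ → FloorReading₁₃ N)
  (jcut : ℕ → ℕ) (sh : ShellSplit₁₃CoPH N K₀) [DecidableEq (Σ K, SiteSeqKey F (K₀ + K))]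

/-- **★★ THE SIZE-DEPENDENT OVER-AGE BOOKING IS PRICED LEVEL BY LEVEL**: at `forgiveCompReading₁₃ K₀ cR`, the reading «`∃ j < jcut`, the FORGIVEN key's level-`j+1` large-field volume lies in
the window `[loR j, hiR j)`» (key-step spelling; `hiR j K` = the budget inverse at the age of level `j+1`, `loR j K ≥ 1` = «a birth exists») has `W K ≤ Σ_{j<jcut K}` of the per-level
WINDOW readings' canonical weights (p622010 §2 at the forgiving dial). [cite: Balaban1989LargeFieldII, (1.79)–(1.80) pp.383–384, (1.85) p.386; King1986, (3.10)–(3.11) p.656 (bookkeeping)] -/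
theorem W_forgiveCompReading₁₃_overAgeWindows_le_sum (K : ℕ) :
    (crOfRecord₁₃KAt K₀ (forgiveCompReading₁₃ K₀ cR)
        (fun F θ hP g₀ os _ x => ∃ j ∈ Finset.range (jcut x.1), loR j F θ hP g₀ os x.1 ≤ largeFieldVolume (j + 1) x.2 ∧ largeFieldVolume (j + 1) x.2 < hiR j F θ hP g₀ os x.1)
        sh F θ hP g₀ os).W K ≤
      ∑ j ∈ Finset.range (jcut K), (crOfRecord₁₃KAt K₀ (forgiveCompReading₁₃ K₀ cR)
        (fun F θ hP g₀ os _ x => loR j F θ hP g₀ os x.1 ≤ largeFieldVolume (j + 1) x.2 ∧ largeFieldVolume (j + 1) x.2 < hiR j F θ hP g₀ os x.1) sh F θ hP g₀ os).W K := by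
  refine W_crOfRecord₁₃KAt_le_sum_of_subset_biUnion θ hP K₀ g₀ os (forgiveCompReading₁₃ K₀ cR) sh _
    (fun j F θ hP g₀ os _ x => loR j F θ hP g₀ os x.1 ≤ largeFieldVolume (j + 1) x.2 ∧ largeFieldVolume (j + 1) x.2 < hiR j F θ hP g₀ os x.1) (Finset.range (jcut K)) K
    fun u hu hb => ?_
  obtain ⟨K', y⟩ := u
  obtain rfl : K' = K :=
    fst_eq_of_mem_classSetK₁₃ θ K₀ g₀ _ (fun K x hx => forgiveKeyCompSigma_fst_eq θ K₀ g₀ (cR F θ hP g₀ os) K x hx) K hu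
  exact hb

/-- **★★ N20 AT THE FORGIVING KEY FROM PER-LEVEL WINDOW BUDGETS**: budgets `w j K` on the per-level window readings' canonical weights (each priceable by §3's per-value socket, or from above by
the threshold rules through `W_crOfRecord₁₃KAt_window_le_thr`), `Σ_{j<jcut K} w j K < 1` at every step and summable over `K` ⇒ the N20 face at the size-dependent over-age booking.
HYPOTHESIS = the per-(level, size-window) letters — NE7b's body at the window key, NAMED OPEN. [cite: Balaban1989LargeFieldII, Thm 1 + (0.1) pp.355–356, (1.79)–(1.80) pp.383–384, (1.85) p.386; King1986, (3.10)–(3.11) p.656 (bookkeeping)] -/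
theorem relWeightBound_forgiveCompReading₁₃_overAgeWindows_of_budgets {w : ℕ → ℕ → ℝ}
    (hw : ∀ K, ∀ j ∈ Finset.range (jcut K), (crOfRecord₁₃KAt K₀ (forgiveCompReading₁₃ K₀ cR)
        (fun F θ hP g₀ os _ x => loR j F θ hP g₀ os x.1 ≤ largeFieldVolume (j + 1) x.2 ∧ largeFieldVolume (j + 1) x.2 < hiR j F θ hP g₀ os x.1) sh F θ hP g₀ os).W K ≤ w j K)
    (hlt : ∀ K, ∑ j ∈ Finset.range (jcut K), w j K < 1) (hsum : Summable fun K => ∑ j ∈ Finset.range (jcut K), w j K) :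
    RelWeightBound
      (crOfRecord₁₃KAt K₀ (forgiveCompReading₁₃ K₀ cR)
        (fun F θ hP g₀ os _ x => ∃ j ∈ Finset.range (jcut x.1), loR j F θ hP g₀ os x.1 ≤ largeFieldVolume (j + 1) x.2 ∧ largeFieldVolume (j + 1) x.2 < hiR j F θ hP g₀ os x.1)
        sh F θ hP g₀ os).l₀
      (crOfRecord₁₃KAt K₀ (forgiveCompReading₁₃ K₀ cR)
        (fun F θ hP g₀ os _ x => ∃ j ∈ Finset.range (jcut x.1), loR j F θ hP g₀ os x.1 ≤ largeFieldVolume (j + 1) x.2 ∧ largeFieldVolume (j + 1) x.2 < hiR j F θ hP g₀ os x.1)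
        sh F θ hP g₀ os).T
      (crOfRecord₁₃KAt K₀ (forgiveCompReading₁₃ K₀ cR)
        (fun F θ hP g₀ os _ x => ∃ j ∈ Finset.range (jcut x.1), loR j F θ hP g₀ os x.1 ≤ largeFieldVolume (j + 1) x.2 ∧ largeFieldVolume (j + 1) x.2 < hiR j F θ hP g₀ os x.1)
        sh F θ hP g₀ os).A
      (crOfRecord₁₃KAt K₀ (forgiveCompReading₁₃ K₀ cR)
        (fun F θ hP g₀ os _ x => ∃ j ∈ Finset.range (jcut x.1), loR j F θ hP g₀ os x.1 ≤ largeFieldVolume (j + 1) x.2 ∧ largeFieldVolume (j + 1) x.2 < hiR j F θ hP g₀ os x.1)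
        sh F θ hP g₀ os).B
      (crOfRecord₁₃KAt K₀ (forgiveCompReading₁₃ K₀ cR)
        (fun F θ hP g₀ os _ x => ∃ j ∈ Finset.range (jcut x.1), loR j F θ hP g₀ os x.1 ≤ largeFieldVolume (j + 1) x.2 ∧ largeFieldVolume (j + 1) x.2 < hiR j F θ hP g₀ os x.1)
        sh F θ hP g₀ os).Bad
      (crOfRecord₁₃KAt K₀ (forgiveCompReading₁₃ K₀ cR)
        (fun F θ hP g₀ os _ x => ∃ j ∈ Finset.range (jcut x.1), loR j F θ hP g₀ os x.1 ≤ largeFieldVolume (j + 1) x.2 ∧ largeFieldVolume (j + 1) x.2 < hiR j F θ hP g₀ os x.1)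
        sh F θ hP g₀ os).W := by
  refine relWeightBound_crOfRecord₁₃KAt_of_pieceBudgets θ hP K₀ g₀ os (forgiveCompReading₁₃ K₀ cR) sh _
    (fun j F θ hP g₀ os _ x => loR j F θ hP g₀ os x.1 ≤ largeFieldVolume (j + 1) x.2 ∧ largeFieldVolume (j + 1) x.2 < hiR j F θ hP g₀ os x.1)
    (fun K => Finset.range (jcut K)) (fun K u hu hb => ?_) hw hlt hsum
  obtain ⟨K', y⟩ := u
  obtain rfl : K' = K :=
    fst_eq_of_mem_classSetK₁₃ θ K₀ g₀ _ (fun K x hx => forgiveKeyCompSigma_fst_eq θ K₀ g₀ (cR F θ hP g₀ os) K x hx) K hu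
  exact hb

end OverAgeWindows

end Summit.QuantumFields.YangMills.BalabanUVNodes.N20KeyedRelWeightValuePredicate

end
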